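import Mathlib
import Literature.NumberTheory.LFunctions.Zhang2022.Section12Ded1217
import Literature.NumberTheory.LFunctions.Zhang2022.Section12Mid1225
import Literature.NumberTheory.LFunctions.Zhang2022.Section8XiZeroTailMeanLogFree
import Literature.NumberTheory.LFunctions.Zhang2022.Section8FrontEnd44Sizes
import Literature.NumberTheory.LFunctions.Zhang2022.Section8Lemma84
import Literature.NumberTheory.LFunctions.Zhang2022.AppendixALemma83RelHolds
import HarnessLib

/-!
# Zhang (2022) §12, (12.11): the middle-range `n`-sum reduced to ONE log-free twisted sum

Topic `Literature/NumberTheory/LFunctions/Zhang2022` (Landau–Siegel audit tree; verdict-neutral).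
Y. Zhang, *Discrete mean estimates and the Landau–Siegel zero*, arXiv:2211.02515v1 (2022)
[Zhang2022LandauSiegel] — **an unrefereed manuscript under adjudication; this theorem-only file
(ZHANG-L discharge lane, WP12, helper under the leaf `Typed.Sec12C.Mid1225`) asserts nothing about
its Theorems 1–2 and nothing about Landau–Siegel zeros.**

(12.11) of Lemma 12.2 [Z22 p.70, tex L3546] — "`Σ_l χ(l)ϰ̄₁₃(drl)ξⱼ(l;d,r)/l ≪ α₁` if
`P″₁/T ≤ dr ≤ P″₁`" — has NO proof in print ("The proof of (12.11) is similar to that of ." [sic],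
tex L3549; GAP row G-L3t5-2). Its object is `Typed.Sec12B.sum122`. This file kernel-checks the
REDUCTION of a bound for it (in the weak shape consumed by `Typed.Sec12C.mid1225_of_eq1211_weak4`,
`≤ C𝓛⁻⁴(dr/φ(dr))⁴`) to a bound for ONE log-free, sharp-cutoff twisted sum:

* `sum122_mid_eq` — the exact decomposition. With `n = dr`, `y = P″₁/n ∈ [1, T)`, `Y = P″₂/n = yP^{0.004}`:
  `sum122 = (log P₁)⁻¹·[ y^{−β₆}( log(P″₂/P″₁)·A(Y) − Y^{β₆}·S₈₄(Y) ) − HEAD ]`, where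
  `A(Y) = Σ_{l<⌈Y⌉} χ(l)ξ₀ⱼ(l;d,r)/l^{1−β₆}` (LOG-FREE), `S₈₄(Y)` is the sum of Lemma 8.4 at
  `μ = 6, x = Y` and `HEAD = Σ_{l ≤ y} χ(l)ξ₀ⱼ(l;d,r)l⁻¹(l/y)^{β₆}log(l/y)`; termwise identity
  `(l/y)^{β₆}log(l/y) = y^{−β₆}[log(Y/y)·l^{β₆} − Y^{β₆}(Y/l)^{−β₆}log(Y/l)]` (`term_split`) and
  `ϰ̄₁₃(nl) = (log P₁)⁻¹(l/y)^{β₆}log(l/y)·1_{y<l<Y}` (`Sec12D.conj_vk13`);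
* `norm_sum122_mid_le` — hence `‖sum122‖ ≤ (log P₁)⁻¹[log(P″₂/P″₁)‖A(Y)‖ + ‖S₈₄(Y)‖ + log y·Σ_{l<⌈T⌉}|ξ₀|/l]`;
* `sum122_mid_bound_of_logfree` — with Lemma 8.4 in its relative reading (a THEOREM of the tree:
  `Skeleton.lemma84Rel_of_lemma83Rel (lemma83Rel_holds c′)`: `‖S₈₄(Y)‖ ≤ |L′||Π||𝔤| + C𝓛⁻⁶(n/φ(n))²
  ≤ C′𝓛²(n/φ(n))²`), the crude log-mean `Σ_{l<⌈T⌉}|ξ₀ⱼ|/l ≤ C(1 + 𝓛^{1.1})³`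
  (`XiZeroMajorant.xiZeroTailMean_logFree`) and `log y ≤ 𝓛^{1.1}`, `log(P″₂/P″₁)/log P₁ = 0.004/0.504`:
  IF `‖A(P″₂/dr)‖ ≤ C𝓛⁻⁴(dr/φ(dr))⁴` on the middle range (hypothesis "LF", INLINE, no new definition)
  THEN `‖sum122‖ ≤ C″𝓛⁻⁴(dr/φ(dr))⁴` there — LITERALLY the hypothesis of `mid1225_of_eq1211_weak4`;
* `Typed.Sec12C.mid1225_of_logfree : 0 ≤ c′ → LF → Mid1225 c′` — the leaf `hMid` of
  `Skeleton.theorem1_of_leaves_v19` thereby rests on LF ALONE. LF is the `w = 0` instance of the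
  object evaluated in the proof of Lemma 12.2 (nodes u024/u025: Gaussian smoothing + a Landau contour
  for `𝔲ⱼ(d,r;s)L(s+β_{j+1},χ)L(s+β_{j+2},χ)/L(s,χ)`, Lemma 8.3); its expected size is
  `O(|Π(d,r)|·|L′(1,χ)|·α) = O(𝓛⁻⁷(dr/φ(dr))²)` (residues at `s = 0` and at the exceptional zero).

No new definition, no named fact; standard axioms.

## References

* Y. Zhang, arXiv:2211.02515v1 (2022), §12 Lemma 12.2 (12.11) p.70 (tex L3546–L3549), (12.9) p.68
  (`ϰ₁₃`), §8 Lemma 8.4 p.46, §7 p.33 (`ξ₀ⱼ`). [cite: Zhang2022LandauSiegel, §12 Lemma 12.2 (12.11) p.70]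
-/

noncomputable section

open Complex Real ComplexConjugate
open Literature.NumberTheory.LFunctions.Zhang2022
open Literature.NumberTheory.LFunctions.Zhang2022.Skeleton

namespace Literature.NumberTheory.LFunctions.Zhang2022.Typed.Sec12B

/-! ### Algebra of the weights -/

section Algebra

/-- A positive real to a complex power, as an exponential: `x^s = e^{(log x)s}`. [folklore] -/
private theorem ofReal_cpow_eq_exp {x : ℝ} (hx : 0 < x) (s : ℂ) :
    ((x : ℝ) : ℂ) ^ s = Complex.exp ((Real.log x : ℂ) * s) := by
  rw [Complex.cpow_def_of_ne_zero (by exact_mod_cast hx.ne'), Complex.ofReal_log hx.le]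

/-- **The termwise identity** behind (12.11) ⇐ Lemma 8.4: for `l, y, Y > 0` and `s ∈ ℂ`,
`(l/y)^s·log(l/y) = y^{−s}·[log(Y/y)·l^s − Y^s·((Y/l)^{−s}log(Y/l))]` — the weight of `ϰ̄₁₃` in
terms of the log-free weight `l^s` and the weight of Lemma 8.4 at `x = Y`.
[cite: Zhang2022LandauSiegel, §12 (12.9), (12.11); §8 Lemma 8.4] -/
theorem term_split {l y Y : ℝ} (hl : 0 < l) (hy : 0 < y) (hY : 0 < Y) (s : ℂ) :
    ((l / y : ℝ) : ℂ) ^ s * (Real.log (l / y) : ℂ) =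
      ((y : ℝ) : ℂ) ^ (-s) * ((Real.log (Y / y) : ℂ) * ((l : ℝ) : ℂ) ^ s -
        ((Y : ℝ) : ℂ) ^ s * (((Y / l : ℝ) : ℂ) ^ (-s) * (Real.log (Y / l) : ℂ))) := by
  rw [ofReal_cpow_eq_exp (div_pos hl hy), ofReal_cpow_eq_exp hy, ofReal_cpow_eq_exp hl,
    ofReal_cpow_eq_exp hY, ofReal_cpow_eq_exp (div_pos hY hl),
    Real.log_div hl.ne' hy.ne', Real.log_div hY.ne' hy.ne', Real.log_div hY.ne' hl.ne']
  push_cast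
  have e1 : Complex.exp (((Real.log l : ℂ) - Real.log y) * s) =
      Complex.exp ((Real.log l : ℂ) * s) * Complex.exp ((Real.log y : ℂ) * (-s)) := by
    rw [← Complex.exp_add]; ring_nf
  have e2 : Complex.exp (((Real.log Y : ℂ) - Real.log l) * (-s)) =
      Complex.exp ((Real.log l : ℂ) * s) * Complex.exp ((Real.log Y : ℂ) * (-s)) := by
    rw [← Complex.exp_add]; ring_nf
  have e3 : Complex.exp ((Real.log Y : ℂ) * s) * Complex.exp ((Real.log Y : ℂ) * (-s)) = 1 := by
    rw [← Complex.exp_add]; ring_nf; rw [Complex.exp_zero]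
  rw [e1, e2]
  linear_combination (Complex.exp ((Real.log l : ℂ) * s) * Complex.exp ((Real.log y : ℂ) * (-s)) *
    ((Real.log Y : ℂ) - Real.log l)) * e3

/-- `l^β/l = 1/l^{1−β}` for a natural number `l ≥ 1`. [folklore] -/
private theorem natCast_cpow_div_self {l : ℕ} (hl : 1 ≤ l) (β : ℂ) :
    ((l : ℝ) : ℂ) ^ β / (l : ℂ) = 1 / (l : ℂ) ^ (1 - β) := by
  have hl0 : (l : ℂ) ≠ 0 := by exact_mod_cast (by omega : l ≠ 0)
  have hlR : ((l : ℝ) : ℂ) = (l : ℂ) := by push_cast; rfl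
  rw [hlR, Complex.cpow_sub _ _ hl0, Complex.cpow_one]
  have h1 : (l : ℂ) ^ (1 - β) ≠ 0 := by
    rw [Complex.cpow_sub _ _ hl0, Complex.cpow_one]
    exact div_ne_zero hl0 (by rw [Complex.cpow_def_of_ne_zero hl0]; exact Complex.exp_ne_zero _)
  field_simp

/-- `‖x^{s}‖ = 1` for a positive real `x` and purely imaginary `s`. [folklore] -/
private theorem norm_ofReal_cpow_of_re_zero {x : ℝ} (hx : 0 < x) {s : ℂ} (hs : s.re = 0) :
    ‖((x : ℝ) : ℂ) ^ s‖ = 1 := by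
  rw [Complex.norm_cpow_eq_rpow_re_of_pos hx, hs, Real.rpow_zero]

end Algebra

/-! ### Sizes on the middle range `P″₁/T < n ≤ P″₁` -/

section Sizes

/-- `1 ≤ Dt₀ ≤ e^{520𝓛}` for `𝓛 ≥ 1`. [cite: Zhang2022LandauSiegel, §2 (2.8)] -/
private theorem D_mul_t0_bounds' {D : ℕ} (h1 : 1 ≤ ell D) :
    1 ≤ (D : ℝ) * t0 D ∧ (D : ℝ) * t0 D ≤ Real.exp (520 * ell D) := by
  have h1' : 1 ≤ Real.log D := by rwa [ell] at h1
  have hD : (D : ℝ) = Real.exp (ell D) := Sec12D.natCast_eq_exp_ell h1'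
  have ht0 : t0 D ≤ Real.exp (519 * ell D) := Sec12D.t0_le_exp h1'
  have ht1 : 1 ≤ t0 D := by rw [t0]; exact one_le_pow₀ h1
  have hD1 : 1 ≤ (D : ℝ) := by rw [hD]; exact Real.one_le_exp (by linarith)
  refine ⟨by nlinarith, ?_⟩
  calc (D : ℝ) * t0 D ≤ Real.exp (ell D) * Real.exp (519 * ell D) := by
        rw [hD]; gcongr
    _ = Real.exp (520 * ell D) := by rw [← Real.exp_add]; ring_nf

/-- `𝓛^{1.1} ≤ 𝓛²` for `𝓛 ≥ 1`. [folklore] -/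
private theorem ell_rpow_le_sq' {D : ℕ} (h1 : 1 ≤ ell D) : ell D ^ (1.1 : ℝ) ≤ ell D ^ 2 := by
  have h : ell D ^ (1.1 : ℝ) ≤ ell D ^ (2 : ℝ) :=
    Real.rpow_le_rpow_of_exponent_le h1 (by norm_num)
  simpa using h

/-- **The geometry of the middle range** (`𝓛 ≥ 5`; `n = dr` with `P″₁/T < n ≤ P″₁`): with
`y = P″₁/n`, `Y = P″₂/n`: `1 ≤ y < T < Y ≤ P″₂ < P`, `n < PT⁻²`, `n < P₁`, and `Y = y·P^{0.004}`.
[cite: Zhang2022LandauSiegel, §12 pp.67–71] -/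
private theorem mid_facts {D : ℕ} (hℓ5 : 5 ≤ ell D) {n : ℕ} (hn : 1 ≤ n)
    (hlo : P1pp D / bigT D < (n : ℝ)) (hhi : (n : ℝ) ≤ P1pp D) :
    1 ≤ P1pp D / n ∧ P1pp D / n < bigT D ∧ bigT D < P2pp D / n ∧ P2pp D / n ≤ P2pp D ∧
      P2pp D < bigP D ∧ (n : ℝ) < bigP D / bigT D ^ 2 ∧ (n : ℝ) < Skeleton.P1 D ∧
      P2pp D / n = bigP D ^ (0.004 : ℝ) * (P1pp D / n) := by
  have h1 : 1 ≤ ell D := by linarith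
  have h0 : 0 < ell D := by linarith
  have hD1 : 1 ≤ Real.log D := by rwa [ell] at h1
  have hℓ3 : 3 ≤ ell D := by linarith
  have hD3 : 3 ≤ Real.log D := by rwa [ell] at hℓ3
  obtain ⟨hDt1, hDt⟩ := D_mul_t0_bounds' h1
  have hP : 0 < bigP D := bigP_pos D
  have hT0 : 0 < bigT D := Real.exp_pos _
  have hn0 : (0 : ℝ) < n := by exact_mod_cast hn
  have hn1 : (1 : ℝ) ≤ n := by exact_mod_cast hn
  have hP1pp : 0 < P1pp D := Sec12D.P1pp_pos hD1
  have hP2pp : 0 < P2pp D := Sec12D.P2pp_pos hD1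
  have h11 := ell_rpow_le_sq' h1
  have h7 : (5 : ℝ) ^ 7 ≤ ell D ^ 7 := pow_le_pow_left₀ (by norm_num) hℓ5 7
  have hrp0 : 0 ≤ ell D ^ (1.1 : ℝ) := Real.rpow_nonneg h0.le _
  -- `P″₂ = P^{0.004}·P″₁`
  have hratio : P2pp D = bigP D ^ (0.004 : ℝ) * P1pp D := by
    have := Sec12D.P2pp_div_P1pp (D := D) hD1
    rw [div_eq_iff hP1pp.ne'] at this
    exact this
  -- `T < P^{0.004}`
  have hT4 : bigT D < bigP D ^ (0.004 : ℝ) := by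
    rw [bigT, show bigP D ^ (0.004 : ℝ) = Real.exp (0.004 * ell D ^ 9) by
      rw [bigP, ← Real.exp_mul]; ring_nf, Real.exp_lt_exp]
    nlinarith [pow_nonneg h0.le 2]
  refine ⟨?_, ?_, ?_, ?_, ?_, ?_, ?_, ?_⟩
  · rw [le_div_iff₀ hn0, one_mul]; exact hhi
  · rw [div_lt_iff₀ hn0]; rw [div_lt_iff₀ hT0] at hlo; linarith
  · rw [lt_div_iff₀ hn0, hratio]
    calc bigT D * n ≤ bigT D * P1pp D := by gcongr
      _ < bigP D ^ (0.004 : ℝ) * P1pp D := by gcongr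
  · exact div_le_self hP2pp.le hn1
  · -- `P″₂ = P^{0.5}·Dt₀ ≤ exp(0.5𝓛⁹ + 520𝓛) < exp(𝓛⁹) = P`
    have h5 : bigP D ^ (0.5 : ℝ) = Real.exp (0.5 * ell D ^ 9) := by
      rw [bigP, ← Real.exp_mul]; ring_nf
    rw [P2pp, h5, mul_assoc]
    calc Real.exp (0.5 * ell D ^ 9) * ((D : ℝ) * t0 D)
        ≤ Real.exp (0.5 * ell D ^ 9) * Real.exp (520 * ell D) := by gcongr
      _ = Real.exp (0.5 * ell D ^ 9 + 520 * ell D) := by rw [← Real.exp_add]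
      _ < bigP D := by
          rw [bigP, Real.exp_lt_exp]; nlinarith [pow_nonneg h0.le 2]
  · calc (n : ℝ) ≤ P1pp D := hhi
      _ < P2pp D := by
          rw [hratio]
          have hP1 : 1 < bigP D := by rw [bigP]; exact Real.one_lt_exp_iff.mpr (by positivity)
          have : 1 < bigP D ^ (0.004 : ℝ) := Real.one_lt_rpow hP1 (by norm_num)
          nlinarith
      _ ≤ bigP D / bigT D ^ 2 := Sec12D.P2pp_le_P_div_T_sq hD3
  · -- `n ≤ P″₁ = exp(0.496𝓛⁹)·Dt₀ ≤ exp(0.496𝓛⁹ + 520𝓛) < exp(0.504𝓛⁹) = P₁`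
    have h496 : bigP D ^ (0.496 : ℝ) = Real.exp (0.496 * ell D ^ 9) := by
      rw [bigP, ← Real.exp_mul]; ring_nf
    calc (n : ℝ) ≤ P1pp D := hhi
      _ = Real.exp (0.496 * ell D ^ 9) * ((D : ℝ) * t0 D) := by rw [P1pp, h496]; ring
      _ ≤ Real.exp (0.496 * ell D ^ 9) * Real.exp (520 * ell D) := by gcongr
      _ = Real.exp (0.496 * ell D ^ 9 + 520 * ell D) := by rw [← Real.exp_add]
      _ < Skeleton.P1 D := by
          rw [Skeleton.P1, show bigP D ^ (0.504 : ℝ) = Real.exp (0.504 * ell D ^ 9) by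
            rw [bigP, ← Real.exp_mul]; ring_nf, Real.exp_lt_exp]
          have h8 : (5 : ℝ) ^ 8 ≤ ell D ^ 8 := pow_le_pow_left₀ (by norm_num) hℓ5 8
          nlinarith
  · rw [hratio]; ring

end Sizes

/-! ### The exact decomposition of `sum122` on the middle range -/

section Decomposition

variable (c' : ℝ) {D : ℕ} (χ : DirichletCharacter ℂ D)

/-- **(12.11), exact decomposition.** For `𝓛 ≥ 5`, `d, r ≥ 1` with `P″₁/T < dr ≤ P″₁`, writing
`n = dr`, `y = P″₁/n`, `Y = P″₂/n`:
`sum122 = (log P₁)⁻¹·( y^{−β₆}·( log(P″₂/P″₁)·Σ_{l<⌈Y⌉} χ(l)ξ₀ⱼ(l;d,r)/l^{1−β₆}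
  − Y^{β₆}·Σ_{l<⌈Y⌉} χ(l)ξ₀ⱼ(l;d,r)l⁻¹(Y/l)^{−β₆}log(Y/l) ) − Σ_{l<⌈Y⌉, l≤y} χ(l)ξ₀ⱼ(l;d,r)l⁻¹(l/y)^{β₆}log(l/y) )`
— the second inner sum is the sum of `Skeleton.Lemma84Rel` at `μ = 6`, `x = Y`; the last ("HEAD")
runs over `l ≤ y < T` only. (`ϰ̄₁₃(nl) = (log P₁)⁻¹(l/y)^{β₆}log(l/y)` exactly on `y < l < Y`, zero
elsewhere: `Sec12D.conj_vk13`.) [cite: Zhang2022LandauSiegel, §12 (12.11) p.70; (12.9) p.68] -/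
theorem sum122_mid_eq (hℓ5 : 5 ≤ ell D) (j : ℕ) {d r : ℕ} (hd : 1 ≤ d) (hr : 1 ≤ r)
    (hlo : P1pp D / bigT D < ((d * r : ℕ) : ℝ)) (hhi : ((d * r : ℕ) : ℝ) ≤ P1pp D) :
    sum122 c' χ j d r =
      (((Real.log (Skeleton.P1 D))⁻¹ : ℝ) : ℂ) *
        ( ((P1pp D / ((d * r : ℕ) : ℝ) : ℝ) : ℂ) ^ (-beta6 D) *
            ( (Real.log (P2pp D / P1pp D) : ℂ) *
                ∑ l ∈ Finset.Ico 1 ⌈P2pp D / ((d * r : ℕ) : ℝ)⌉₊,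
                  χ (l : ZMod D) * xiZero c' D j l d r / (l : ℂ) ^ (1 - beta6 D)
              - ((P2pp D / ((d * r : ℕ) : ℝ) : ℝ) : ℂ) ^ (beta6 D) *
                ∑ l ∈ Finset.Ico 1 ⌈P2pp D / ((d * r : ℕ) : ℝ)⌉₊,
                  χ (l : ZMod D) * xiZero c' D j l d r / (l : ℂ) *
                    ((P2pp D / ((d * r : ℕ) : ℝ) / l : ℝ) : ℂ) ^ (-betaMu D 6) *
                      (Real.log (P2pp D / ((d * r : ℕ) : ℝ) / l) : ℂ) )
          - ∑ l ∈ (Finset.Ico 1 ⌈P2pp D / ((d * r : ℕ) : ℝ)⌉₊).filter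
              (fun l : ℕ => (l : ℝ) ≤ P1pp D / ((d * r : ℕ) : ℝ)),
              χ (l : ZMod D) * xiZero c' D j l d r / (l : ℂ) *
                (((l : ℝ) / (P1pp D / ((d * r : ℕ) : ℝ)) : ℝ) : ℂ) ^ (beta6 D) *
                  (Real.log ((l : ℝ) / (P1pp D / ((d * r : ℕ) : ℝ))) : ℂ) ) := by
  classical
  have hdr1 : 1 ≤ d * r := Nat.mul_pos hd hr
  obtain ⟨-, -, -, hYP2, -, -, -, -⟩ := mid_facts hℓ5 hdr1 hlo hhi
  have h1 : 1 ≤ ell D := by linarith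
  have hD1 : 1 ≤ Real.log D := by rwa [ell] at h1
  have hP1pp : 0 < P1pp D := Sec12D.P1pp_pos hD1
  have hP2pp : 0 < P2pp D := Sec12D.P2pp_pos hD1
  set n : ℕ := d * r with hn
  have hn0 : (0 : ℝ) < (n : ℝ) := by exact_mod_cast hdr1
  set y : ℝ := P1pp D / (n : ℝ) with hy
  set Y : ℝ := P2pp D / (n : ℝ) with hY
  have hy0 : 0 < y := div_pos hP1pp hn0
  have hY0 : 0 < Y := div_pos hP2pp hn0
  have hβ : betaMu D 6 = beta6 D := by simp [betaMu]
  -- the weight of sum122 and the three auxiliary weights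
  set w : ℕ → ℂ := fun l => χ (l : ZMod D) * xiZero c' D j l d r / (l : ℂ) *
    (((l : ℝ) / y : ℝ) : ℂ) ^ (beta6 D) * (Real.log ((l : ℝ) / y) : ℂ) with hw
  set c₀ : ℂ := (((Real.log (Skeleton.P1 D))⁻¹ : ℝ) : ℂ) with hc₀
  -- Step 1: `sum122 = Σ_{l<⌈Y⌉} [y < l]·c₀·w(l)`
  have step1 : sum122 c' χ j d r =
      ∑ l ∈ Finset.Ico 1 ⌈Y⌉₊, (if y < (l : ℝ) then c₀ * w l else 0) := by
    rw [sum122]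
    have hsub : Finset.Ico 1 ⌈Y⌉₊ ⊆ Finset.Ico 1 ⌈P2pp D⌉₊ :=
      Finset.Ico_subset_Ico_right (Nat.ceil_mono hYP2)
    rw [← Finset.sum_subset hsub]
    · refine Finset.sum_congr rfl fun l hl => ?_
      rw [Finset.mem_Ico] at hl
      have hl0 : (0 : ℝ) < l := by exact_mod_cast hl.1
      have hlY : (l : ℝ) < Y := Nat.lt_ceil.mp hl.2
      have hcast : ((d * r * l : ℕ) : ℝ) = (n : ℝ) * l := by rw [hn]; push_cast; ring
      have hup : ((d * r * l : ℕ) : ℝ) < P2pp D := by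
        rw [hcast]; rw [hY, lt_div_iff₀ hn0] at hlY; linarith
      have hquot : ((d * r * l : ℕ) : ℝ) / P1pp D = (l : ℝ) / y := by
        rw [hcast, hy]; field_simp
      rw [Sec12D.conj_vk13]
      by_cases hyl : y < (l : ℝ)
      · have hlow : P1pp D < ((d * r * l : ℕ) : ℝ) := by
          rw [hcast]; rw [hy, div_lt_iff₀ hn0] at hyl; linarith
        rw [if_pos ⟨hlow, hup⟩, if_pos hyl, hquot]
        simp only [hw, hc₀]
        ring
      · have hlow : ¬ (P1pp D < ((d * r * l : ℕ) : ℝ) ∧ ((d * r * l : ℕ) : ℝ) < P2pp D) := by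
          rintro ⟨h1', -⟩
          apply hyl
          rw [hcast] at h1'
          rw [hy, div_lt_iff₀ hn0]; linarith
        rw [if_neg hlow, if_neg hyl]
        simp
    · intro l hl hl'
      rw [Finset.mem_Ico] at hl
      have hlY : Y ≤ (l : ℝ) := by
        by_contra h
        exact hl' (Finset.mem_Ico.mpr ⟨hl.1, Nat.lt_ceil.mpr (not_le.mp h)⟩)
      have hcast : ((d * r * l : ℕ) : ℝ) = (n : ℝ) * l := by rw [hn]; push_cast; ring
      have hup : ¬ (P1pp D < ((d * r * l : ℕ) : ℝ) ∧ ((d * r * l : ℕ) : ℝ) < P2pp D) := by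
        rintro ⟨-, h2⟩
        rw [hcast] at h2
        rw [hY, div_le_iff₀ hn0] at hlY
        linarith
      rw [Sec12D.conj_vk13, if_neg hup]
      simp
  -- Step 2: `Σ [y<l] c₀ w = c₀ (Σ w − Σ_{l ≤ y} w)`
  have step2 : ∑ l ∈ Finset.Ico 1 ⌈Y⌉₊, (if y < (l : ℝ) then c₀ * w l else 0) =
      c₀ * (∑ l ∈ Finset.Ico 1 ⌈Y⌉₊, w l -
        ∑ l ∈ (Finset.Ico 1 ⌈Y⌉₊).filter (fun l : ℕ => (l : ℝ) ≤ y), w l) := by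
    rw [← Finset.sum_filter, ← Finset.mul_sum]
    congr 1
    have hsplit := Finset.sum_filter_add_sum_filter_not (Finset.Ico 1 ⌈Y⌉₊)
      (fun l : ℕ => y < (l : ℝ)) w
    have hnot : (Finset.Ico 1 ⌈Y⌉₊).filter (fun l : ℕ => ¬ y < (l : ℝ)) =
        (Finset.Ico 1 ⌈Y⌉₊).filter (fun l : ℕ => (l : ℝ) ≤ y) := by
      refine Finset.filter_congr fun l _ => ?_
      exact not_lt
    rw [hnot] at hsplit
    exact eq_sub_of_add_eq hsplit
  -- Step 3: the full sum via `term_split`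
  have step3 : ∑ l ∈ Finset.Ico 1 ⌈Y⌉₊, w l =
      ((y : ℝ) : ℂ) ^ (-beta6 D) *
        ( (Real.log (P2pp D / P1pp D) : ℂ) *
            ∑ l ∈ Finset.Ico 1 ⌈Y⌉₊, χ (l : ZMod D) * xiZero c' D j l d r / (l : ℂ) ^ (1 - beta6 D)
          - ((Y : ℝ) : ℂ) ^ (beta6 D) *
            ∑ l ∈ Finset.Ico 1 ⌈Y⌉₊, χ (l : ZMod D) * xiZero c' D j l d r / (l : ℂ) *
              ((Y / l : ℝ) : ℂ) ^ (-betaMu D 6) * (Real.log (Y / l) : ℂ) ) := by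
    have hYy' : Real.log (P2pp D / P1pp D) = Real.log (Y / y) := by
      congr 1
      rw [hY, hy]; field_simp
    rw [hYy']
    simp only [mul_sub, Finset.mul_sum]
    rw [← Finset.sum_sub_distrib]
    refine Finset.sum_congr rfl fun l hl => ?_
    rw [Finset.mem_Ico] at hl
    have hl1 : 1 ≤ l := hl.1
    have hl0 : (0 : ℝ) < l := by exact_mod_cast hl.1
    have key := term_split hl0 hy0 hY0 (beta6 D)
    have hdiv := natCast_cpow_div_self hl1 (beta6 D)
    simp only [hw, hβ]
    -- `w l = (χξ₀/l)·[(l/y)^β log(l/y)]`, then `term_split`, then `l^β/l = 1/l^{1−β}`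
    calc χ (l : ZMod D) * xiZero c' D j l d r / (l : ℂ) * (((l : ℝ) / y : ℝ) : ℂ) ^ beta6 D *
          (Real.log ((l : ℝ) / y) : ℂ)
        = χ (l : ZMod D) * xiZero c' D j l d r / (l : ℂ) *
            ((((l : ℝ) / y : ℝ) : ℂ) ^ beta6 D * (Real.log ((l : ℝ) / y) : ℂ)) := by ring
      _ = χ (l : ZMod D) * xiZero c' D j l d r / (l : ℂ) *
            (((y : ℝ) : ℂ) ^ (-beta6 D) * ((Real.log (Y / y) : ℂ) * ((l : ℝ) : ℂ) ^ beta6 D -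
              ((Y : ℝ) : ℂ) ^ beta6 D * (((Y / l : ℝ) : ℂ) ^ (-beta6 D) * (Real.log (Y / l) : ℂ)))) := by
          rw [key]
      _ = ((y : ℝ) : ℂ) ^ (-beta6 D) * ((Real.log (Y / y) : ℂ) *
              (χ (l : ZMod D) * xiZero c' D j l d r * (((l : ℝ) : ℂ) ^ beta6 D / (l : ℂ)))) -
            ((y : ℝ) : ℂ) ^ (-beta6 D) * (((Y : ℝ) : ℂ) ^ beta6 D *
              (χ (l : ZMod D) * xiZero c' D j l d r / (l : ℂ) * ((Y / l : ℝ) : ℂ) ^ (-beta6 D) *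
                (Real.log (Y / l) : ℂ))) := by ring
      _ = _ := by rw [hdiv]; ring
  rw [step1, step2, step3]

/-- **(12.11), the resulting majorant**: on the middle range (`𝓛 ≥ 5`),
`‖sum122‖ ≤ (log P₁)⁻¹·( log(P″₂/P″₁)·‖A(Y)‖ + ‖S₈₄(Y)‖ + log y·Σ_{l<⌈T⌉}|ξ₀ⱼ(l;d,r)|/l )` with
`A(Y)`, `S₈₄(Y)` the two inner sums of `sum122_mid_eq` (`|y^{−β₆}| = |Y^{β₆}| = |(l/y)^{β₆}| = 1`,
`|log(l/y)| ≤ log y` for `1 ≤ l ≤ y`, and `l ≤ y < T`). [cite: Zhang2022LandauSiegel, §12 (12.11) p.70] -/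
theorem norm_sum122_mid_le (hℓ5 : 5 ≤ ell D) (j : ℕ) {d r : ℕ} (hd : 1 ≤ d) (hr : 1 ≤ r)
    (hlo : P1pp D / bigT D < ((d * r : ℕ) : ℝ)) (hhi : ((d * r : ℕ) : ℝ) ≤ P1pp D) :
    ‖sum122 c' χ j d r‖ ≤
      (Real.log (Skeleton.P1 D))⁻¹ *
        ( Real.log (P2pp D / P1pp D) *
            ‖∑ l ∈ Finset.Ico 1 ⌈P2pp D / ((d * r : ℕ) : ℝ)⌉₊,
                χ (l : ZMod D) * xiZero c' D j l d r / (l : ℂ) ^ (1 - beta6 D)‖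
          + ‖∑ l ∈ Finset.Ico 1 ⌈P2pp D / ((d * r : ℕ) : ℝ)⌉₊,
                χ (l : ZMod D) * xiZero c' D j l d r / (l : ℂ) *
                  ((P2pp D / ((d * r : ℕ) : ℝ) / l : ℝ) : ℂ) ^ (-betaMu D 6) *
                    (Real.log (P2pp D / ((d * r : ℕ) : ℝ) / l) : ℂ)‖
          + Real.log (P1pp D / ((d * r : ℕ) : ℝ)) *
              ∑ l ∈ Finset.Ico 1 ⌈bigT D⌉₊, ‖xiZero c' D j l d r‖ / l ) := by
  classical
  have hdr1 : 1 ≤ d * r := Nat.mul_pos hd hr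
  rw [sum122_mid_eq c' χ hℓ5 j hd hr hlo hhi]
  obtain ⟨hy1, hyT, -, -, -, -, -, -⟩ := mid_facts hℓ5 hdr1 hlo hhi
  have h1 : 1 ≤ ell D := by linarith
  have h0 : 0 < ell D := by linarith
  have hD1 : 1 ≤ Real.log D := by rwa [ell] at h1
  have hn0 : (0 : ℝ) < ((d * r : ℕ) : ℝ) := by exact_mod_cast hdr1
  have hP1pp : 0 < P1pp D := Sec12D.P1pp_pos hD1
  have hP2pp : 0 < P2pp D := Sec12D.P2pp_pos hD1
  set y : ℝ := P1pp D / ((d * r : ℕ) : ℝ) with hy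
  set Y : ℝ := P2pp D / ((d * r : ℕ) : ℝ) with hY
  have hy0 : 0 < y := div_pos hP1pp hn0
  have hY0 : 0 < Y := div_pos hP2pp hn0
  -- `log P₁ > 0`
  have hlogP1 : 0 < Real.log (Skeleton.P1 D) := by
    rw [Sec12D.log_P1_eq_mul, Skeleton.log_bigP]; positivity
  have hκ : 0 ≤ Real.log (P2pp D / P1pp D) := by
    rw [Sec12D.P2pp_div_P1pp hD1]
    exact Real.log_nonneg (Real.one_le_rpow (by rw [bigP]; exact Real.one_le_exp (by positivity))
      (by norm_num))
  have hre : (beta6 D).re = 0 := by simp [beta6]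
  have hny : ‖((y : ℝ) : ℂ) ^ (-beta6 D)‖ = 1 := norm_ofReal_cpow_of_re_zero hy0 (by simp [hre])
  have hnY : ‖((Y : ℝ) : ℂ) ^ (beta6 D)‖ = 1 := norm_ofReal_cpow_of_re_zero hY0 hre
  have hc₀ : ‖(((Real.log (Skeleton.P1 D))⁻¹ : ℝ) : ℂ)‖ = (Real.log (Skeleton.P1 D))⁻¹ := by
    rw [Complex.norm_real, Real.norm_of_nonneg (inv_nonneg.mpr hlogP1.le)]
  have hlogκ : ‖(Real.log (P2pp D / P1pp D) : ℂ)‖ = Real.log (P2pp D / P1pp D) := by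
    rw [Complex.norm_real, Real.norm_of_nonneg hκ]
  -- the HEAD
  set A := ∑ l ∈ Finset.Ico 1 ⌈Y⌉₊, χ (l : ZMod D) * xiZero c' D j l d r / (l : ℂ) ^ (1 - beta6 D)
    with hA
  set S := ∑ l ∈ Finset.Ico 1 ⌈Y⌉₊, χ (l : ZMod D) * xiZero c' D j l d r / (l : ℂ) *
    ((Y / l : ℝ) : ℂ) ^ (-betaMu D 6) * (Real.log (Y / l) : ℂ) with hS
  set H := ∑ l ∈ (Finset.Ico 1 ⌈Y⌉₊).filter (fun l : ℕ => (l : ℝ) ≤ y),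
    χ (l : ZMod D) * xiZero c' D j l d r / (l : ℂ) * (((l : ℝ) / y : ℝ) : ℂ) ^ (beta6 D) *
      (Real.log ((l : ℝ) / y) : ℂ) with hH
  have hHle : ‖H‖ ≤ Real.log y * ∑ l ∈ Finset.Ico 1 ⌈bigT D⌉₊, ‖xiZero c' D j l d r‖ / l := by
    have hsub : (Finset.Ico 1 ⌈Y⌉₊).filter (fun l : ℕ => (l : ℝ) ≤ y) ⊆ Finset.Ico 1 ⌈bigT D⌉₊ := by
      intro l hl
      rw [Finset.mem_filter, Finset.mem_Ico] at hl
      rw [Finset.mem_Ico]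
      exact ⟨hl.1.1, Nat.lt_ceil.mpr (lt_of_le_of_lt hl.2 hyT)⟩
    calc ‖H‖ ≤ ∑ l ∈ (Finset.Ico 1 ⌈Y⌉₊).filter (fun l : ℕ => (l : ℝ) ≤ y),
          ‖χ (l : ZMod D) * xiZero c' D j l d r / (l : ℂ) * (((l : ℝ) / y : ℝ) : ℂ) ^ (beta6 D) *
            (Real.log ((l : ℝ) / y) : ℂ)‖ := norm_sum_le _ _
      _ ≤ ∑ l ∈ (Finset.Ico 1 ⌈Y⌉₊).filter (fun l : ℕ => (l : ℝ) ≤ y),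
          ‖xiZero c' D j l d r‖ / l * Real.log y := by
          refine Finset.sum_le_sum fun l hl => ?_
          rw [Finset.mem_filter, Finset.mem_Ico] at hl
          have hl0 : (0 : ℝ) < l := by exact_mod_cast hl.1.1
          have hl1 : (1 : ℝ) ≤ l := by exact_mod_cast hl.1.1
          have hly : (l : ℝ) ≤ y := hl.2
          have hq0 : 0 < (l : ℝ) / y := div_pos hl0 hy0
          have hq1 : (l : ℝ) / y ≤ 1 := by rw [div_le_one hy0]; exact hly
          rw [norm_mul, norm_mul, norm_div, norm_mul, Complex.norm_natCast,
            norm_ofReal_cpow_of_re_zero hq0 hre, mul_one, Complex.norm_real, Real.norm_eq_abs]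
          have hlogabs : |Real.log ((l : ℝ) / y)| ≤ Real.log y := by
            rw [abs_of_nonpos (Real.log_nonpos hq0.le hq1), Real.log_div hl0.ne' hy0.ne']
            have : 0 ≤ Real.log l := Real.log_nonneg hl1
            linarith
          have hχ : ‖χ (l : ZMod D)‖ ≤ 1 := χ.norm_le_one _
          calc ‖χ (l : ZMod D)‖ * ‖xiZero c' D j l d r‖ / (l : ℝ) * |Real.log ((l : ℝ) / y)|
              ≤ 1 * ‖xiZero c' D j l d r‖ / (l : ℝ) * Real.log y := by gcongr
            _ = ‖xiZero c' D j l d r‖ / l * Real.log y := by ring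
      _ = Real.log y * ∑ l ∈ (Finset.Ico 1 ⌈Y⌉₊).filter (fun l : ℕ => (l : ℝ) ≤ y),
          ‖xiZero c' D j l d r‖ / l := by
          rw [Finset.mul_sum]; refine Finset.sum_congr rfl fun l _ => ?_; ring
      _ ≤ Real.log y * ∑ l ∈ Finset.Ico 1 ⌈bigT D⌉₊, ‖xiZero c' D j l d r‖ / l :=
          mul_le_mul_of_nonneg_left
            (Finset.sum_le_sum_of_subset_of_nonneg hsub fun l _ _ => by positivity)
            (Real.log_nonneg hy1)
  calc ‖(((Real.log (Skeleton.P1 D))⁻¹ : ℝ) : ℂ) *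
        (((y : ℝ) : ℂ) ^ (-beta6 D) * ((Real.log (P2pp D / P1pp D) : ℂ) * A -
          ((Y : ℝ) : ℂ) ^ (beta6 D) * S) - H)‖
      ≤ (Real.log (Skeleton.P1 D))⁻¹ * (1 * (Real.log (P2pp D / P1pp D) * ‖A‖ + 1 * ‖S‖) + ‖H‖) := by
        rw [norm_mul, hc₀]
        refine mul_le_mul_of_nonneg_left ?_ (inv_nonneg.mpr hlogP1.le)
        refine (norm_sub_le _ _).trans (add_le_add ?_ le_rfl)
        rw [norm_mul, hny]
        refine mul_le_mul_of_nonneg_left ?_ zero_le_one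
        refine (norm_sub_le _ _).trans (add_le_add ?_ ?_)
        · rw [norm_mul, hlogκ]
        · rw [norm_mul, hnY]
    _ ≤ (Real.log (Skeleton.P1 D))⁻¹ * (Real.log (P2pp D / P1pp D) * ‖A‖ + ‖S‖ +
          Real.log y * ∑ l ∈ Finset.Ico 1 ⌈bigT D⌉₊, ‖xiZero c' D j l d r‖ / l) := by
        rw [one_mul, one_mul]
        gcongr

end Decomposition

/-! ### The bound of (12.11)-type from the log-free sum -/

section Bound

variable (c' : ℝ)

/-- The relative factor of Lemma 8.4 is `(n/φ(n))²`: `∏_{q∣n}(1 − q⁻¹)⁻¹ = n/φ(n)`.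
[cite: HallTenenbaum1988, §0.2] -/
private theorem prod_one_sub_inv_inv_eq_ratio {n : ℕ} (hn : n ≠ 0) :
    ∏ q ∈ n.primeFactors, (1 - (q : ℝ)⁻¹)⁻¹ = (n : ℝ) / Nat.totient n := by
  rw [self_div_totient_eq_prod hn]
  refine Finset.prod_congr rfl fun q hq => ?_
  have hq2 : (2 : ℝ) ≤ q := by exact_mod_cast (Nat.prime_of_mem_primeFactors hq).two_le
  have hq0 : (q : ℝ) ≠ 0 := by linarith
  have hq1 : (q : ℝ) - 1 ≠ 0 := by linarith
  field_simp

/-- **(12.11) in the weak shape `‖sum122‖ ≤ C𝓛⁻⁴(dr/φ(dr))⁴` on `P″₁/T < dr ≤ P″₁`, REDUCED to the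
log-free twisted sum** (every real `c′`): if, under (A) and for `D` large,
`‖Σ_{l<⌈P″₂/dr⌉} χ(l)ξ₀ⱼ(l;d,r)/l^{1−β₆}‖ ≤ C·𝓛⁻⁴·(dr/φ(dr))⁴` on the middle range (hypothesis "LF",
inline), then the same shape of bound holds for `sum122` — by `norm_sum122_mid_le` with the relative
Lemma 8.4 (`Skeleton.lemma84Rel_of_lemma83Rel (lemma83Rel_holds c′)`, a theorem; `‖S₈₄‖ ≤
|L′||Π||𝔤_{j6}| + C𝓛⁻⁶(dr/φ(dr))² ≤ C′𝓛²(dr/φ(dr))²` via `Lemma31.norm_deriv_LFunction_le_near_one`,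
`Skeleton.norm_PiW_le`, `Section8FrontEnd44Sizes.norm_frakgW_le`), the crude log-mean
`XiZeroMajorant.xiZeroTailMean_logFree` (`Σ_{l<⌈T⌉}|ξ₀|/l ≤ C(1+𝓛^{1.1})³`, `log y ≤ 𝓛^{1.1}`:
HEAD `≤ 16C𝓛^{4.4}`), and `log(P″₂/P″₁) = 0.004𝓛⁹`, `log P₁ = 0.504𝓛⁹`. The conclusion is LITERALLY
the hypothesis of `Typed.Sec12C.mid1225_of_eq1211_weak4`. [cite: Zhang2022LandauSiegel, §12 Lemma 12.2 (12.11) p.70] -/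
theorem sum122_mid_bound_of_logfree
    (hLF : ∃ C : ℝ, ForAllLarge fun D _ χ => AssumptionA D χ →
      ∀ j ∈ ({1, 2, 3} : Finset ℕ), ∀ d r : ℕ, 1 ≤ d → 1 ≤ r →
        P1pp D / bigT D < ((d * r : ℕ) : ℝ) → ((d * r : ℕ) : ℝ) ≤ P1pp D →
          ‖∑ l ∈ Finset.Ico 1 ⌈P2pp D / ((d * r : ℕ) : ℝ)⌉₊,
              χ (l : ZMod D) * xiZero c' D j l d r / (l : ℂ) ^ (1 - beta6 D)‖ ≤
            C * (ell D ^ 4)⁻¹ * ((((d * r : ℕ) : ℝ)) / Nat.totient (d * r)) ^ 4) :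
    ∃ C : ℝ, ForAllLarge fun D _ χ => AssumptionA D χ →
      ∀ j ∈ ({1, 2, 3} : Finset ℕ), ∀ d r : ℕ, 1 ≤ d → 1 ≤ r →
        P1pp D / bigT D < ((d * r : ℕ) : ℝ) → ((d * r : ℕ) : ℝ) ≤ P1pp D →
          ‖sum122 c' χ j d r‖ ≤
            C * (ell D ^ 4)⁻¹ * ((((d * r : ℕ) : ℝ)) / Nat.totient (d * r)) ^ 4 := by
  obtain ⟨CL, DL, HL⟩ := hLF
  obtain ⟨C4, D4, H4⟩ := lemma84Rel_of_lemma83Rel (lemma83Rel_holds c')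
  obtain ⟨CX, DX, HX⟩ := XiZeroMajorant.xiZeroTailMean_logFree c'
  -- constants
  obtain ⟨G0, hG0def⟩ : ∃ G0 : ℝ, G0 = 1 + 8 * (1 + 20 * |c'|) ^ 2 + (5.5 + 60 * |c'|) ^ 2 * π :=
    ⟨_, rfl⟩
  have hG0 : 0 ≤ G0 := by rw [hG0def]; positivity
  obtain ⟨CL', hCL'⟩ : ∃ CL' : ℝ, CL' = max CL 0 := ⟨_, rfl⟩
  have hCL'0 : 0 ≤ CL' := by rw [hCL']; exact le_max_right _ _
  have hCLle : CL ≤ CL' := by rw [hCL']; exact le_max_left _ _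
  obtain ⟨C4', hC4'⟩ : ∃ C4' : ℝ, C4' = max C4 0 := ⟨_, rfl⟩
  have hC4'0 : 0 ≤ C4' := by rw [hC4']; exact le_max_right _ _
  have hC4le : C4 ≤ C4' := by rw [hC4']; exact le_max_left _ _
  obtain ⟨CX', hCX'⟩ : ∃ CX' : ℝ, CX' = max CX 0 := ⟨_, rfl⟩
  have hCX'0 : 0 ≤ CX' := by rw [hCX']; exact le_max_right _ _
  have hCXle : CX ≤ CX' := by rw [hCX']; exact le_max_left _ _
  refine ⟨0.004 / 0.504 * CL' + 2 * (4 * Real.exp (9 / 2) * G0 + C4') + 32 * CX',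
    max (max (max DL D4) DX) ⌈Real.exp 5⌉₊, fun D _ χ hD hq hp hA j hj d r hd hr hlo hhi => ?_⟩
  have hDL : DL ≤ D := le_trans (le_max_left _ _) (le_trans (le_max_left _ _) (le_trans (le_max_left _ _) hD))
  have hD4 : D4 ≤ D := le_trans (le_max_right _ _) (le_trans (le_max_left _ _) (le_trans (le_max_left _ _) hD))
  have hDX : DX ≤ D := le_trans (le_max_right _ _) (le_trans (le_max_left _ _) hD)
  have hℓ5 : 5 ≤ ell D := by
    rw [ell]
    have hD' : Real.exp 5 ≤ (D : ℝ) := (Nat.le_ceil _).trans (by exact_mod_cast le_of_max_le_right hD)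
    exact (Real.le_log_iff_exp_le ((Real.exp_pos 5).trans_le hD')).mpr hD'
  have hℓ3 : 3 ≤ ell D := by linarith
  have h1 : 1 ≤ ell D := by linarith
  have h0 : 0 < ell D := by linarith
  have hD1 : 1 ≤ Real.log D := by rwa [ell] at h1
  have hD3nat : 3 ≤ D := by
    by_contra h
    have hD2 : (D : ℝ) ≤ 2 := by exact_mod_cast (by omega : D ≤ 2)
    have hlogle : Real.log D ≤ Real.log 2 := by
      rcases Nat.eq_zero_or_pos D with h0' | h0'
      · subst h0'
        simp only [Nat.cast_zero, Real.log_zero]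
        exact Real.log_nonneg one_le_two
      · exact Real.log_le_log (by exact_mod_cast h0') hD2
    have hlt := Real.log_two_lt_d9
    rw [ell] at h1
    linarith
  have hdr0 : 0 < d * r := Nat.mul_pos hd hr
  have hdr1 : 1 ≤ d * r := hdr0
  obtain ⟨-, hyT, hTY, hYP2, hP2P, hnN, hnP1, -⟩ := mid_facts hℓ5 hdr1 hlo hhi
  have hn0 : (0 : ℝ) < ((d * r : ℕ) : ℝ) := by exact_mod_cast hdr1
  have hP1pp : 0 < P1pp D := Sec12D.P1pp_pos hD1
  set y : ℝ := P1pp D / ((d * r : ℕ) : ℝ) with hy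
  set Y : ℝ := P2pp D / ((d * r : ℕ) : ℝ) with hY
  have hT1 : 1 ≤ bigT D := Sec10C.one_le_bigT D
  have hy0 : 0 < y := div_pos hP1pp hn0
  have hY1 : 1 ≤ Y := hT1.trans hTY.le
  have hYP : Y ≤ bigP D := hYP2.trans hP2P.le
  set ρ : ℝ := (((d * r : ℕ) : ℝ)) / Nat.totient (d * r) with hρ
  have hρ1 : 1 ≤ ρ := one_le_self_div_totient hdr0.ne'
  have hρ2 : 1 ≤ ρ ^ 2 := one_le_pow₀ hρ1
  have hρ4 : ρ ^ 2 ≤ ρ ^ 4 := by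
    calc ρ ^ 2 = ρ ^ 2 * 1 := (mul_one _).symm
      _ ≤ ρ ^ 2 * ρ ^ 2 := by gcongr
      _ = ρ ^ 4 := by ring
  -- the three instances
  have HLD := HL D χ hDL hq hp hA j hj d r hd hr hlo hhi
  have H4D := H4 D χ hD4 hq hp hA j hj 6 (by simp) d r hd hr hnN Y hTY (hYP2.trans_lt hP2P)
  have HXD := HX D χ hDX hq hp j hj d r hd hr hnP1 (bigT D) hT1 le_rfl
  -- the relative factor of Lemma 8.4 is `ρ²`
  have hprod : (∏ q ∈ (d * r).primeFactors, (1 - (q : ℝ)⁻¹)⁻¹) ^ 2 = ρ ^ 2 := by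
    rw [hρ, prod_one_sub_inv_inv_eq_ratio hdr0.ne']
  rw [hprod] at H4D
  -- `‖S₈₄‖ ≤ |L′||Π||𝔤| + C₄'ρ²𝓛⁻⁶ ≤ (4e^{9/2}G₀ + C₄')𝓛²ρ²`
  have hLp : ‖deriv χ.LFunction 1‖ ≤ 4 * Real.exp (9 / 2) * ell D ^ 2 := by
    have hq3 : 3 ≤ Real.log (D : ℕ) := by simpa [ell] using hℓ3
    have h := Lemma31.norm_deriv_LFunction_le_near_one (χ := χ) hq3 hp (w := 1)
      (by rw [sub_self, norm_zero]; exact div_nonneg zero_le_one (by linarith))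
    rw [← ell] at h
    calc ‖deriv χ.LFunction 1‖ ≤ 2 * Real.exp (9 / 2) * (1 + ell D) * ell D := h
      _ ≤ 2 * Real.exp (9 / 2) * (2 * ell D) * ell D := by gcongr; linarith
      _ = 4 * Real.exp (9 / 2) * ell D ^ 2 := by ring
  have hPiW : ‖PiW χ d r‖ ≤ ρ ^ 2 := by rw [hρ]; exact norm_PiW_le χ (by omega) (by omega)
  have hg : ‖frakgW c' D j 6 Y‖ ≤ G0 := by
    rw [hG0def]; exact Section8FrontEnd44Sizes.norm_frakgW_le c' hD3nat j 6 hY1 hYP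
  have hS : ‖∑ l ∈ Finset.Ico 1 ⌈Y⌉₊, χ (l : ZMod D) * xiZero c' D j l d r / (l : ℂ) *
        ((Y / l : ℝ) : ℂ) ^ (-betaMu D 6) * (Real.log (Y / l) : ℂ)‖ ≤
      (4 * Real.exp (9 / 2) * G0 + C4') * ell D ^ 2 * ρ ^ 2 := by
    have h1' := norm_le_norm_add_norm_sub'
      (∑ l ∈ Finset.Ico 1 ⌈Y⌉₊, χ (l : ZMod D) * xiZero c' D j l d r / (l : ℂ) *
        ((Y / l : ℝ) : ℂ) ^ (-betaMu D 6) * (Real.log (Y / l) : ℂ))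
      (deriv χ.LFunction 1 * PiW χ d r * frakgW c' D j 6 Y)
    have hmain : ‖deriv χ.LFunction 1 * PiW χ d r * frakgW c' D j 6 Y‖ ≤
        4 * Real.exp (9 / 2) * ell D ^ 2 * ρ ^ 2 * G0 := by
      rw [norm_mul, norm_mul]; gcongr
    have herr : C4 * (ell D ^ 6)⁻¹ * ρ ^ 2 ≤ C4' * ell D ^ 2 * ρ ^ 2 := by
      have hl6 : (1 : ℝ) ≤ ell D ^ 6 := one_le_pow₀ h1
      have hinv : (ell D ^ 6)⁻¹ ≤ 1 := inv_le_one_of_one_le₀ hl6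
      have hℓ2 : (1 : ℝ) ≤ ell D ^ 2 := one_le_pow₀ h1
      calc C4 * (ell D ^ 6)⁻¹ * ρ ^ 2 ≤ C4' * (ell D ^ 6)⁻¹ * ρ ^ 2 := by gcongr
        _ ≤ C4' * 1 * ρ ^ 2 := by gcongr
        _ ≤ C4' * ell D ^ 2 * ρ ^ 2 := by gcongr
    linarith [H4D.trans herr]
  -- HEAD: `log y · Σ_{l<⌈T⌉}|ξ₀|/l ≤ 𝓛^{1.1}·CX'(1+𝓛^{1.1})³ ≤ 16 CX' 𝓛⁵`
  have hlogy : Real.log y ≤ ell D ^ (1.1 : ℝ) := by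
    calc Real.log y ≤ Real.log (bigT D) := Real.log_le_log hy0 hyT.le
      _ = ell D ^ (1.1 : ℝ) := by rw [bigT, Real.log_exp]
  have hrp1 : 1 ≤ ell D ^ (1.1 : ℝ) := Real.one_le_rpow h1 (by norm_num)
  have hrp5 : ell D ^ (1.1 : ℝ) * (1 + ell D ^ (1.1 : ℝ)) ^ 3 ≤ 16 * ell D ^ 5 := by
    have h2 : 1 + ell D ^ (1.1 : ℝ) ≤ 2 * ell D ^ (1.1 : ℝ) := by linarith
    have h44 : (ell D ^ (1.1 : ℝ)) ^ 4 ≤ ell D ^ 5 := by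
      rw [← Real.rpow_natCast, ← Real.rpow_mul h0.le]
      calc ell D ^ ((1.1 : ℝ) * (4 : ℕ)) ≤ ell D ^ (5 : ℝ) :=
            Real.rpow_le_rpow_of_exponent_le h1 (by norm_num)
        _ = ell D ^ 5 := by rw [show (5 : ℝ) = (5 : ℕ) by norm_num, Real.rpow_natCast]
    calc ell D ^ (1.1 : ℝ) * (1 + ell D ^ (1.1 : ℝ)) ^ 3
        ≤ ell D ^ (1.1 : ℝ) * (2 * ell D ^ (1.1 : ℝ)) ^ 3 := by gcongr
      _ = 8 * (ell D ^ (1.1 : ℝ)) ^ 4 := by ring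
      _ ≤ 8 * ell D ^ 5 := by gcongr
      _ ≤ 16 * ell D ^ 5 := by linarith [pow_pos h0 5]
  have hHX : Real.log y * ∑ l ∈ Finset.Ico 1 ⌈bigT D⌉₊, ‖xiZero c' D j l d r‖ / l ≤
      16 * CX' * ell D ^ 5 := by
    have hsum0 : 0 ≤ ∑ l ∈ Finset.Ico 1 ⌈bigT D⌉₊, ‖xiZero c' D j l d r‖ / l :=
      Finset.sum_nonneg fun l _ => by positivity
    have hlogT : Real.log (bigT D) = ell D ^ (1.1 : ℝ) := by rw [bigT, Real.log_exp]
    have h3 : 0 ≤ (1 + Real.log (bigT D)) ^ 3 := by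
      rw [hlogT]; exact pow_nonneg (by positivity) 3
    have hX' : ∑ l ∈ Finset.Ico 1 ⌈bigT D⌉₊, ‖xiZero c' D j l d r‖ / l ≤
        CX' * (1 + Real.log (bigT D)) ^ 3 :=
      HXD.trans (mul_le_mul_of_nonneg_right hCXle h3)
    calc Real.log y * ∑ l ∈ Finset.Ico 1 ⌈bigT D⌉₊, ‖xiZero c' D j l d r‖ / l
        ≤ ell D ^ (1.1 : ℝ) * (CX' * (1 + Real.log (bigT D)) ^ 3) :=
          mul_le_mul hlogy hX' hsum0 (Real.rpow_nonneg h0.le _)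
      _ = CX' * (ell D ^ (1.1 : ℝ) * (1 + ell D ^ (1.1 : ℝ)) ^ 3) := by rw [hlogT]; ring
      _ ≤ CX' * (16 * ell D ^ 5) := by gcongr
      _ = 16 * CX' * ell D ^ 5 := by ring
  -- the log-free sum
  have hA : ‖∑ l ∈ Finset.Ico 1 ⌈Y⌉₊, χ (l : ZMod D) * xiZero c' D j l d r / (l : ℂ) ^ (1 - beta6 D)‖ ≤
      CL' * (ell D ^ 4)⁻¹ * ρ ^ 4 := HLD.trans (by gcongr)
  -- logs of the scales
  have hκ : Real.log (P2pp D / P1pp D) = 0.004 * ell D ^ 9 := by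
    rw [Sec12D.P2pp_div_P1pp hD1, Real.log_rpow (bigP_pos D), Skeleton.log_bigP]
  have hlogP1 : Real.log (Skeleton.P1 D) = 0.504 * ell D ^ 9 := by
    rw [Sec12D.log_P1_eq_mul, Skeleton.log_bigP]
  have hl9 : 0 < ell D ^ 9 := by positivity
  -- assemble
  have key := norm_sum122_mid_le c' χ hℓ5 j hd hr hlo hhi
  rw [← hy, ← hY] at key
  have hκ0 : 0 ≤ Real.log (P2pp D / P1pp D) := by rw [hκ]; positivity
  have hinv0 : 0 ≤ (Real.log (Skeleton.P1 D))⁻¹ := by rw [hlogP1]; positivity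
  set B : ℝ := 4 * Real.exp (9 / 2) * G0 + C4' with hB
  have hB0 : 0 ≤ B := by positivity
  have hℓne : ell D ≠ 0 := h0.ne'
  -- the three pieces against `(ℓ⁴)⁻¹ρ⁴`
  have hρ4' : (1 : ℝ) ≤ ρ ^ 4 := one_le_pow₀ hρ1
  have hl4 : 0 < ell D ^ 4 := by positivity
  have t1 : (0.504 * ell D ^ 9)⁻¹ * (0.004 * ell D ^ 9 * (CL' * (ell D ^ 4)⁻¹ * ρ ^ 4)) =
      0.004 / 0.504 * CL' * (ell D ^ 4)⁻¹ * ρ ^ 4 := by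
    field_simp
  have t2 : (0.504 * ell D ^ 9)⁻¹ * (B * ell D ^ 2 * ρ ^ 2) ≤ 2 * B * (ell D ^ 4)⁻¹ * ρ ^ 4 := by
    have e : (0.504 * ell D ^ 9)⁻¹ * (B * ell D ^ 2 * ρ ^ 2) =
        (1 / 0.504) * B * ρ ^ 2 * (ell D ^ 7)⁻¹ := by
      field_simp
    rw [e]
    have h74 : (ell D ^ 7)⁻¹ ≤ (ell D ^ 4)⁻¹ :=
      inv_anti₀ hl4 (pow_le_pow_right₀ h1 (by norm_num))
    calc 1 / 0.504 * B * ρ ^ 2 * (ell D ^ 7)⁻¹ ≤ 2 * B * ρ ^ 4 * (ell D ^ 4)⁻¹ := by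
          gcongr; norm_num
      _ = 2 * B * (ell D ^ 4)⁻¹ * ρ ^ 4 := by ring
  have t3 : (0.504 * ell D ^ 9)⁻¹ * (16 * CX' * ell D ^ 5) ≤ 32 * CX' * (ell D ^ 4)⁻¹ * ρ ^ 4 := by
    have e : (0.504 * ell D ^ 9)⁻¹ * (16 * CX' * ell D ^ 5) = (16 / 0.504) * CX' * (ell D ^ 4)⁻¹ := by
      field_simp
    rw [e]
    calc 16 / 0.504 * CX' * (ell D ^ 4)⁻¹ ≤ 32 * CX' * (ell D ^ 4)⁻¹ := by gcongr; norm_num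
      _ = 32 * CX' * (ell D ^ 4)⁻¹ * 1 := (mul_one _).symm
      _ ≤ 32 * CX' * (ell D ^ 4)⁻¹ * ρ ^ 4 := by gcongr
  calc ‖sum122 c' χ j d r‖ ≤ _ := key
    _ ≤ (Real.log (Skeleton.P1 D))⁻¹ * (Real.log (P2pp D / P1pp D) * (CL' * (ell D ^ 4)⁻¹ * ρ ^ 4) +
          B * ell D ^ 2 * ρ ^ 2 + 16 * CX' * ell D ^ 5) := by
        rw [hB]; gcongr
    _ = (0.504 * ell D ^ 9)⁻¹ * (0.004 * ell D ^ 9 * (CL' * (ell D ^ 4)⁻¹ * ρ ^ 4)) +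
          (0.504 * ell D ^ 9)⁻¹ * (B * ell D ^ 2 * ρ ^ 2) +
          (0.504 * ell D ^ 9)⁻¹ * (16 * CX' * ell D ^ 5) := by
        rw [hκ, hlogP1]; ring
    _ ≤ 0.004 / 0.504 * CL' * (ell D ^ 4)⁻¹ * ρ ^ 4 + 2 * B * (ell D ^ 4)⁻¹ * ρ ^ 4 +
          32 * CX' * (ell D ^ 4)⁻¹ * ρ ^ 4 := by rw [t1]; gcongr
    _ = (0.004 / 0.504 * CL' + 2 * B + 32 * CX') * (ell D ^ 4)⁻¹ * ρ ^ 4 := by ring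
    _ = (0.004 / 0.504 * CL' + 2 * (4 * Real.exp (9 / 2) * G0 + C4') + 32 * CX') *
          (ell D ^ 4)⁻¹ * ((((d * r : ℕ) : ℝ)) / Nat.totient (d * r)) ^ 4 := by rw [hB]

end Bound

end Literature.NumberTheory.LFunctions.Zhang2022.Typed.Sec12B

/-! ### The leaf `hMid` from the log-free sum -/

namespace Literature.NumberTheory.LFunctions.Zhang2022.Typed.Sec12C

open Literature.NumberTheory.LFunctions.Zhang2022.Typed.Sec12B (sum122 sum122_mid_bound_of_logfree)

/-- **`Typed.Sec12C.Mid1225` from the log-free twisted sum alone** (for `c′ ≥ 0`): the middle range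
`P″₁/T < dr ≤ P″₁` of `S_j(𝐚₁₂,𝐚₂₅)` contributes `o(α)` as soon as
`‖Σ_{l<⌈P″₂/dr⌉} χ(l)ξ₀ⱼ(l;d,r)/l^{1−β₆}‖ ≤ C𝓛⁻⁴(dr/φ(dr))⁴` there (under (A), `D` large) —
`mid1225_of_eq1211_weak4 ∘ sum122_mid_bound_of_logfree`; everything else the printed sentence
(p.71, tex L3605) and (12.11) consume is a theorem of the tree (Lemmas 8.2, 8.3, 8.4 relative, the
`ξ₀ⱼ` log-mean). [cite: Zhang2022LandauSiegel, §12 (12.12) p.71, tex L3605; Lemma 12.2 (12.11) p.70] -/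
theorem mid1225_of_logfree (c' : ℝ) (hc' : 0 ≤ c')
    (hLF : ∃ C : ℝ, ForAllLarge fun D _ χ => AssumptionA D χ →
      ∀ j ∈ ({1, 2, 3} : Finset ℕ), ∀ d r : ℕ, 1 ≤ d → 1 ≤ r →
        P1pp D / bigT D < ((d * r : ℕ) : ℝ) → ((d * r : ℕ) : ℝ) ≤ P1pp D →
          ‖∑ l ∈ Finset.Ico 1 ⌈P2pp D / ((d * r : ℕ) : ℝ)⌉₊,
              χ (l : ZMod D) * xiZero c' D j l d r / (l : ℂ) ^ (1 - beta6 D)‖ ≤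
            C * (ell D ^ 4)⁻¹ * ((((d * r : ℕ) : ℝ)) / Nat.totient (d * r)) ^ 4) :
    Mid1225 c' :=
  mid1225_of_eq1211_weak4 c' hc' (sum122_mid_bound_of_logfree c' hLF)

end Literature.NumberTheory.LFunctions.Zhang2022.Typed.Sec12C
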